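import Summits.SmoothPoincare4.SmoothPoincare4.Theses.EntropyRung
import Literature.Geometry.Riemannian.GaussianShrinker
import Literature.Geometry.Riemannian.ShrinkingRoundSphereFour
import Literature.Geometry.Riemannian.RoundCylinderFourVolume
import Literature.Geometry.Riemannian.PuncturedShrinkingSphereFour

/-!
# Every hypothesis of `NoncompactShrinkerGap` is load-bearing (negative lemmas for crux stmt-SmoothPoincare4-10868)

The crux `EntropyRung.NoncompactShrinkerGap` (route EntropyRung, rank 2) asserts: a connected, NON-COMPACT,
COMPLETE (closed `g`-balls compact) 4-manifold with a smooth NORMALISED gradient shrinking soliton structure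
`Ric + Hess f = g/2`, `R + |∇f|² = f`, which is NON-FLAT (`R ≢ 0`), has
`∫ e^{-f} dV ≤ 32π²√π e^{-3/2}` (`= (4π)² Θ(S³×ℝ)`, Cao–Hamilton–Ilmanen 2004 §4). This file records,
as kernel-checked theorems over the tree's own vocabulary, that the statement becomes FALSE when any one
of four hypotheses is deleted — so every proof of the crux must use each of them:

* non-flatness — the Gaussian shrinker `(ℝ⁴, δ, |x|²/4)`: `∫ e^{-f} = 16π² > 32π²√πe^{-3/2}`
  (`noncompactShrinkerGap_false_without_nonflat`; also shows the hypothesis bundle is satisfiable);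
* non-compactness — the round shrinking sphere `S⁴(√6)`, `f ≡ 2`: `∫ = 96π²e⁻² ≈ 128.2 > 124.9`
  (`noncompactShrinkerGap_false_without_noncompact`; CHI: `Θ(S⁴) = 6/e² = .812 > .791`, margin 2.7 %);
* completeness — the punctured sphere `S⁴(√6) ∖ pt = (ℝ⁴, 96(|y|²+4)⁻²δ)`, `f ≡ 2`, same integral
  (`noncompactShrinkerGap_false_without_complete`);
* the normalisation `R + |∇f|² = f` — the round cylinder `S³(2)×ℝ = (ℝ⁴∖0, 4|y|⁻²δ)` with the shifted
  potential `f − 1`: `∫ = e · 32π²√πe^{-3/2}` (`noncompactShrinkerGap_false_without_normalisation`).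

(Connectedness is load-bearing too — two disjoint cylinders — but needs a disjoint-union manifold API; not here.)
The geometric cores are the Literature models `GaussianShrinker`, `ShrinkingRoundSphereFour`,
`PuncturedShrinkingSphereFour`, `RoundCylinderFour*`. Refuter negative lemmas (cdisprove gen 1–2), support the
crux item; statements are the crux text verbatim with exactly one clause removed.
-/

noncomputable section

set_option linter.dupNamespace false

namespace Summit.SmoothPoincare4.SmoothPoincare4.Theorems.NoncompactShrinkerGap.Negative

open scoped Manifold ContDiff ENNReal NNReal RealInnerProductSpace ContinuousMap
open MeasureTheory
open Literature.Geometry.Riemannian Literature.Geometry.Lorentzian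
open Literature.Geometry.Lorentzian.PseudoRiemannianMetric

/-- **Non-flatness is load-bearing** (and the hypotheses of the crux are jointly satisfiable): the crux
with `∃ x, R x ≠ 0` deleted is refuted by the Gaussian shrinker `(ℝ⁴, δ, |x|²/4)`, which is complete,
smooth, solves `Ric + Hess f = g/2` and `R + |∇f|² = f`, and has `∫ e^{-f} dV = 16π² > 32π²√πe^{-3/2}`
(`Θ(ℝ⁴) = 1 > Θ(S³×ℝ) = .791`). [cite: CaoHamiltonIlmanen2004, §4] -/
theorem noncompactShrinkerGap_false_without_nonflat :
    ¬ (∀ (M : Type) [TopologicalSpace M] [T2Space M] [SecondCountableTopology M]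
        [ChartedSpace (EuclideanSpace ℝ (Fin 4)) M] [IsManifold (𝓡 4) ∞ M] [ConnectedSpace M]
        [NoncompactSpace M] [T3Space M] [MeasurableSpace M] [BorelSpace M]
        (g : PseudoRiemannianMetric (𝓡 4) ∞ (EuclideanSpace ℝ (Fin 4)) (TangentSpace (𝓡 4) : M → Type _))
        [g.HasLeviCivita] (f : M → ℝ) (hg : g.IsRiemannian),
        (∀ (x : M) (r : NNReal), IsCompact {y : M | g.edist hg x y ≤ r}) →
        ContMDiff (𝓡 4) 𝓘(ℝ, ℝ) ∞ f →
        (∀ (x : M) (X Y : TangentSpace (𝓡 4) x),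
          g.ricci x X Y + g.hessian f x X Y = (1 / 2 : ℝ) * g.val x X Y) →
        (∀ x : M, g.scalarCurvature x + g.gradSq f x = f x) →
        ∫⁻ x, ENNReal.ofReal (Real.exp (-f x))
            ∂(riemannianMeasure (g.toContMDiffRiemannianMetric hg)) ≤
          ENNReal.ofReal (32 * Real.pi ^ 2 * Real.sqrt Real.pi * Real.exp (-(3 : ℝ) / 2))) := by
  intro h
  have hsol : ∀ (x : EuclideanFour) (X Y : TangentSpace (𝓡 4) x),
      (euclideanMetric EuclideanFour).ricci x X Y +
          (euclideanMetric EuclideanFour).hessian gaussianPotential x X Y =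
        (1 / 2 : ℝ) * (euclideanMetric EuclideanFour).val x X Y := fun x X Y ↦ by
    rw [ricci_euclideanMetric, hessian_gaussianPotential, euclideanMetric_apply,
      LinearMap.zero_apply, LinearMap.zero_apply]
    ring_nf
    rfl
  have hnorm : ∀ x : EuclideanFour, (euclideanMetric EuclideanFour).scalarCurvature x +
      (euclideanMetric EuclideanFour).gradSq gaussianPotential x = gaussianPotential x := fun x ↦ by
    rw [scalarCurvature_euclideanMetric, gradSq_gaussianPotential, zero_add]
  have key := h EuclideanFour (euclideanMetric EuclideanFour) gaussianPotential
    isRiemannian_euclideanMetric isCompact_setOf_edist_euclideanMetric_le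
    contDiff_gaussianPotential.contMDiff hsol hnorm
  change ∫⁻ x, ENNReal.ofReal (Real.exp (-gaussianPotential x)) ∂(riemannianMeasure euclideanFourMetric)
    ≤ _ at key
  rw [riemannianMeasure_euclideanFour, lintegral_exp_neg_gaussianPotential,
    ENNReal.ofReal_le_ofReal_iff (by positivity)] at key
  exact absurd key (not_le.mpr cylinderDensityBound_lt_gaussian)

/-- **Non-compactness is load-bearing**: the crux with the binder `[NoncompactSpace M]` deleted is
refuted by the round shrinking sphere `S⁴(√6) ⊂ ℝ⁵` with `f ≡ 2` (`Ric = ½g`, `R = 2 ≠ 0`, `Hess 2 = 0`,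
`|∇2|² = 0`, complete, connected), for which `∫ e^{-2} dV = 96π²e⁻² ≈ 128.2 > 124.9`
(`Θ(S⁴) = 6/e² = .812 > .791 = Θ(S³×ℝ)`, i.e. `πe < 9`). So any proof must separate `S⁴`, whose density
exceeds the bound by the factor `1.0266`. [cite: CaoHamiltonIlmanen2004, §4] -/
theorem noncompactShrinkerGap_false_without_noncompact :
    ¬ (∀ (M : Type) [TopologicalSpace M] [T2Space M] [SecondCountableTopology M]
        [ChartedSpace (EuclideanSpace ℝ (Fin 4)) M] [IsManifold (𝓡 4) ∞ M] [ConnectedSpace M]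
        [T3Space M] [MeasurableSpace M] [BorelSpace M]
        (g : PseudoRiemannianMetric (𝓡 4) ∞ (EuclideanSpace ℝ (Fin 4)) (TangentSpace (𝓡 4) : M → Type _))
        [g.HasLeviCivita] (f : M → ℝ) (hg : g.IsRiemannian),
        (∀ (x : M) (r : NNReal), IsCompact {y : M | g.edist hg x y ≤ r}) →
        ContMDiff (𝓡 4) 𝓘(ℝ, ℝ) ∞ f →
        (∀ (x : M) (X Y : TangentSpace (𝓡 4) x),
          g.ricci x X Y + g.hessian f x X Y = (1 / 2 : ℝ) * g.val x X Y) →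
        (∀ x : M, g.scalarCurvature x + g.gradSq f x = f x) →
        (∃ x : M, g.scalarCurvature x ≠ 0) →
        ∫⁻ x, ENNReal.ofReal (Real.exp (-f x))
            ∂(riemannianMeasure (g.toContMDiffRiemannianMetric hg)) ≤
          ENNReal.ofReal (32 * Real.pi ^ 2 * Real.sqrt Real.pi * Real.exp (-(3 : ℝ) / 2))) := by
  intro h
  haveI : Nonempty SphereFour := (NormedSpace.sphere_nonempty.2 zero_le_one).to_subtype
  have hsol : ∀ (x : SphereFour) (X Y : TangentSpace (𝓡 4) x),
      shrinkingSphereFourMetric.ricci x X Y +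
          shrinkingSphereFourMetric.hessian (fun _ ↦ (2 : ℝ)) x X Y =
        (1 / 2 : ℝ) * shrinkingSphereFourMetric.val x X Y := by
    intro x X Y
    rw [ricci_shrinkingSphereFourMetric, shrinkingSphereFourMetric.hessian_constFun,
      LinearMap.zero_apply, LinearMap.zero_apply, add_zero]
  have hnorm : ∀ x : SphereFour, shrinkingSphereFourMetric.scalarCurvature x +
      shrinkingSphereFourMetric.gradSq (fun _ ↦ (2 : ℝ)) x = 2 := by
    intro x
    rw [scalarCurvature_shrinkingSphereFourMetric, PseudoRiemannianMetric.gradSq_const, add_zero]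
  have hnf : ∃ x : SphereFour, shrinkingSphereFourMetric.scalarCurvature x ≠ 0 :=
    ⟨Classical.arbitrary SphereFour, by rw [scalarCurvature_shrinkingSphereFourMetric]; norm_num⟩
  have key := h SphereFour shrinkingSphereFourMetric (fun _ ↦ (2 : ℝ))
    isRiemannian_shrinkingSphereFourMetric isCompact_setOf_edist_shrinkingSphereFour_le
    contMDiff_const hsol hnorm hnf
  rw [lintegral_exp_neg_two_shrinkingSphereFour, ENNReal.ofReal_le_ofReal_iff (by positivity)] at key
  exact absurd key (not_le.mpr cylinderDensityBound_lt_shrinkingSphereFour)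

/-- **Completeness is load-bearing**: the crux with "closed `g`-balls are compact" deleted is refuted by
the punctured shrinking sphere `S⁴(√6) ∖ {pt}`, realised as the conformally flat metric
`96(|y|²+4)⁻²δ` on `ℝ⁴`, with `f ≡ 2`: connected, non-compact, a normalised shrinker with `R = 2 ≠ 0`,
INCOMPLETE, and `∫ e^{-2} dV = 96π²e⁻² > 32π²√πe^{-3/2}` (a point is `dV`-null). [folklore] -/
theorem noncompactShrinkerGap_false_without_complete :
    ¬ (∀ (M : Type) [TopologicalSpace M] [T2Space M] [SecondCountableTopology M]
        [ChartedSpace (EuclideanSpace ℝ (Fin 4)) M] [IsManifold (𝓡 4) ∞ M] [ConnectedSpace M]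
        [NoncompactSpace M] [T3Space M] [MeasurableSpace M] [BorelSpace M]
        (g : PseudoRiemannianMetric (𝓡 4) ∞ (EuclideanSpace ℝ (Fin 4)) (TangentSpace (𝓡 4) : M → Type _))
        [g.HasLeviCivita] (f : M → ℝ) (hg : g.IsRiemannian),
        ContMDiff (𝓡 4) 𝓘(ℝ, ℝ) ∞ f →
        (∀ (x : M) (X Y : TangentSpace (𝓡 4) x),
          g.ricci x X Y + g.hessian f x X Y = (1 / 2 : ℝ) * g.val x X Y) →
        (∀ x : M, g.scalarCurvature x + g.gradSq f x = f x) →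
        (∃ x : M, g.scalarCurvature x ≠ 0) →
        ∫⁻ x, ENNReal.ofReal (Real.exp (-f x))
            ∂(riemannianMeasure (g.toContMDiffRiemannianMetric hg)) ≤
          ENNReal.ofReal (32 * Real.pi ^ 2 * Real.sqrt Real.pi * Real.exp (-(3 : ℝ) / 2))) := by
  intro h
  have hpt : PuncturedSphereFour.W4 := ⟨0, trivial⟩
  have hnf : ∃ x : PuncturedSphereFour.W4, PuncturedSphereFour.punctP.scalarCurvature x ≠ 0 :=
    ⟨hpt, PuncturedSphereFour.scalarCurvature_ne_zero hpt⟩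
  have key := h PuncturedSphereFour.W4 PuncturedSphereFour.punctP (fun _ ↦ (2 : ℝ))
    PuncturedSphereFour.isRiemannian_punctP contMDiff_const PuncturedSphereFour.soliton_two
    PuncturedSphereFour.normalisation_two hnf
  rw [PuncturedSphereFour.lintegral_exp_neg_two, ENNReal.ofReal_le_ofReal_iff (by positivity)] at key
  exact absurd key (not_le.mpr cylinderDensityBound_lt_shrinkingSphereFour)

/-- **The normalisation `R + |∇f|² = f` is load-bearing**: the crux with that clause deleted (only
`Ric + Hess f = g/2` kept) is refuted by the round cylinder `S³(2)×ℝ = (ℝ⁴∖0, 4|y|⁻²δ)` with the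
SHIFTED potential `f − 1 = (log|y|)² + 1/2`: the same Hessian, every other hypothesis intact, and
`∫ e^{-(f−1)} dV = e · 32π²√πe^{-3/2} > 32π²√πe^{-3/2}`. The normalisation is what pins the additive
constant in `f`, hence the weighted volume. [folklore] -/
theorem noncompactShrinkerGap_false_without_normalisation :
    ¬ (∀ (M : Type) [TopologicalSpace M] [T2Space M] [SecondCountableTopology M]
        [ChartedSpace (EuclideanSpace ℝ (Fin 4)) M] [IsManifold (𝓡 4) ∞ M] [ConnectedSpace M]
        [NoncompactSpace M] [T3Space M] [MeasurableSpace M] [BorelSpace M]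
        (g : PseudoRiemannianMetric (𝓡 4) ∞ (EuclideanSpace ℝ (Fin 4)) (TangentSpace (𝓡 4) : M → Type _))
        [g.HasLeviCivita] (f : M → ℝ) (hg : g.IsRiemannian),
        (∀ (x : M) (r : NNReal), IsCompact {y : M | g.edist hg x y ≤ r}) →
        ContMDiff (𝓡 4) 𝓘(ℝ, ℝ) ∞ f →
        (∀ (x : M) (X Y : TangentSpace (𝓡 4) x),
          g.ricci x X Y + g.hessian f x X Y = (1 / 2 : ℝ) * g.val x X Y) →
        (∃ x : M, g.scalarCurvature x ≠ 0) →
        ∫⁻ x, ENNReal.ofReal (Real.exp (-f x))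
            ∂(riemannianMeasure (g.toContMDiffRiemannianMetric hg)) ≤
          ENNReal.ofReal (32 * Real.pi ^ 2 * Real.sqrt Real.pi * Real.exp (-(3 : ℝ) / 2))) := by
  intro h
  have hpt : RoundCylinderFour.P4 := ⟨EuclideanSpace.single 0 1, by
    change EuclideanSpace.single (0 : Fin 4) (1 : ℝ) ∈ ({(0 : EuclideanFour)}ᶜ : Set EuclideanFour)
    simp⟩
  have hnf : ∃ x : RoundCylinderFour.P4, RoundCylinderFour.cylP.scalarCurvature x ≠ 0 :=
    ⟨hpt, RoundCylinderFour.scalarCurvature_ne_zero hpt⟩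
  have key := h RoundCylinderFour.P4 RoundCylinderFour.cylP RoundCylinderFour.fP1
    RoundCylinderFour.isRiemannian_cylP RoundCylinderFour.isCompact_setOf_edist_le
    RoundCylinderFour.contMDiff_fP1 RoundCylinderFour.soliton_fP1 hnf
  change ∫⁻ p, ENNReal.ofReal (Real.exp (-RoundCylinderFour.fP1 p))
      ∂(riemannianMeasure RoundCylinderFour.hC) ≤ _ at key
  rw [RoundCylinderFour.lintegral_exp_neg_fP1, ENNReal.ofReal_le_ofReal_iff (by positivity)] at key
  exact absurd key (not_le.mpr RoundCylinderFour.bound_lt_shifted)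

end Summit.SmoothPoincare4.SmoothPoincare4.Theorems.NoncompactShrinkerGap.Negative

end
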